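import Summits.Langlands.Langlands.Theses.StickelbergerDial
import Literature.NumberTheory.GaloisRepresentations.AbsIrreducibleIndexTwo
import Literature.RepresentationTheory.Semisimple.BurnsideMatrixSpan

/-!
# `StickelbergerDial.SectorComplement` (stmt-Langlands-17964) — the GALOIS side of the sector is
# inside the summit: the target exceeds the summit only on the automorphic side
# (negative-side support for the junction; refuter cdisprove seat, cycle 1, 2026-08-17; sorry-free)

The junction `C := StickelbergerDial.SectorComplement := WeightZeroNonOrdinaryPA → Langlands`
(rank 9, "the rest of `GL_n` reciprocity", never staffed) has the landed position file
`Theorems/StickelbergerDialSectorComplement.lean` (`¬ C ↔ X ∧ ¬ Langlands`, `Langlands → C`,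
`C ↔ Langlands` under the target X or under the route's door + engine).  Unlike the sibling frames
(`EisensteinGelfandKirillov`, `DyadicOddResidue`: `Langlands ↔ X ∧ C`), here `Langlands → X` is
NOT available as typed.  This file locates the obstruction exactly, kernel-checked:

* `galoisSide_of_langlands` — **`Langlands →` (binders and hypotheses of `WeightZeroNonOrdinaryPA`
  VERBATIM ⇒ the conclusion of the summit's direction (B) over `K` itself, for every reciprocity
  datum `𝓡` and every compactness witness `hcpt`)**: an L-algebraic cuspidal `π` of `GL_n(𝔸_K)`
  with `Corresponds 𝓡 ι π r` (a.e. Satake–Frobenius matching in the summit's normalisation and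
  local–global compatibility at every finite place).  So the Galois-theoretic input of the sector
  (a.e. unramified; crystalline at the PINNED Fontaine datum, which is `𝓡.pst` by definition;
  residual bundle) lies inside the hypotheses of (B), and the whole DRIFT of the target over the
  summit is automorphic-side: `Pi.1.HasWeightZero` (the summit has no archimedean /
  Hodge–Tate-cocharacter clause, statement audit 2026-08-14), `Pi` unramified above `ℓ`, the HLTT
  (C-algebraic, weight-0) dictionary `arithFrobPolyOfSatake ι q_v n α` versus the summit's
  L-algebraic `arithFrobPolyOfSatake ι q_v 1 α` (the twist `|det|^{(n-1)/2}`), `∃ hcpt'` versus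
  `∀ hcpt`, and the extension `K'/K`.  Consequence for refuters: a counterexample to the target
  either violates `galoisSide_of_langlands`'s conclusion — then it REFUTES the formal summit — or
  lives in the drift — then it proves the junction ex falso and does not touch the summit; in no
  case does it refute the junction (`¬ C ↔ X ∧ ¬ Langlands`).
* `isIrreducible_of_isResidualRepOf`, `isResiduallyAbsIrreducible_of_isResidualRepOf` — the one
  non-bookkeeping step: the target's residual bundle `r.IsResidualRepOf (RingHom.id _) τ`,
  `IsAbsIrreducible τ` (ACC+ shape: `τ` a SEMISIMPLIFIED reduction) gives
  `r.IsResiduallyAbsIrreducible` (some REDUCTION absolutely irreducible), hence (accepted Burnside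
  bridge) `r.toGaloisRep.IsIrreducible`, the hypothesis of (B); decomposed genericity, enormous
  image and the scalar element are not needed.
* `isAbsIrreducible_of_isSemisimplificationOf`, `span_eq_top_of_trace_eq` — the underlying
  representation theory, any field, any characteristic: absolute irreducibility passes from a
  semisimplification `τ` to the representation `τ₀` it semisimplifies, by Burnside
  (`span_eq_top_iff_forall_isIrreducible`, in tree) and a TRACE TRANSFER of spanning: equal traces
  and "the `τ(g)` span `M_n(k)`" force "the `τ₀(g)` span `M_n(k)`" (non-degeneracy of the trace
  form, `Matrix.ext_iff_trace_mul_right`, and injective ⇒ surjective on `M_n(k)`).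

Nothing here asserts the junction, the target, any route item or the summit.  Work file with the
full disprover's analysis: `Cruxes/SectorComplement/Disproof.lean`, PART III (`sd_` prefix).
-/

set_option linter.dupNamespace false -- project-wide option; `Summit.Langlands.Langlands` is the mandated namespace

noncomputable section

namespace Summit.Langlands.Langlands.Theorems.SectorComplement.Negative

open scoped MatrixGroups
open Literature.NumberTheory.GaloisRepresentations Literature.RepresentationTheory.Semisimple
open Summit.Langlands.Langlands.Theses.StickelbergerDial

/-! ## Trace transfer of Burnside spanning -/

section TraceTransfer

variable {G : Type*} [Group G] {k : Type*} [Field k] {n : ℕ}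

/-- **Trace transfer of Burnside spanning.** If two matrix representations `φ ψ : G → GL_n(k)` of
a group have the same traces, `tr φ(g) = tr ψ(g)` for all `g`, and the matrices `φ(g)` span
`M_n(k)`, then so do the `ψ(g)`.  (The trace form `tr(XY)` is non-degenerate on `M_n(k)`; a linear
relation `Σ c_g ψ(g) = 0` gives `Σ c_g tr ψ(gh) = 0`, i.e. `tr((Σ c_g φ(g)) φ(h)) = 0` for all `h`,
whence `Σ c_g φ(g) = 0` because the `φ(h)` span; so `ψ ∘ σ` is an injective, hence surjective,
endomorphism of `M_n(k)` for any linear section `σ` of `c ↦ Σ c_g φ(g)`.)  Any characteristic.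
(Curtis–Reiner (27.8); Darmon–Diamond–Taylor 1995 §2.1.) [folklore] -/
theorem span_eq_top_of_trace_eq (φ ψ : G →* GL (Fin n) k)
    (htr : ∀ g, ((φ g : GL (Fin n) k) : Matrix (Fin n) (Fin n) k).trace =
      ((ψ g : GL (Fin n) k) : Matrix (Fin n) (Fin n) k).trace)
    (hφ : Submodule.span k (Set.range fun g => ((φ g : GL (Fin n) k) : Matrix (Fin n) (Fin n) k)) = ⊤) :
    Submodule.span k (Set.range fun g => ((ψ g : GL (Fin n) k) : Matrix (Fin n) (Fin n) k)) = ⊤ := by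
  classical
  -- the linear maps `θ : c ↦ Σ c_g φ(g)` and `θ' : c ↦ Σ c_g ψ(g)` on `G →₀ k`
  let θ : (G →₀ k) →ₗ[k] Matrix (Fin n) (Fin n) k :=
    Finsupp.linearCombination k fun g => ((φ g : GL (Fin n) k) : Matrix (Fin n) (Fin n) k)
  let θ' : (G →₀ k) →ₗ[k] Matrix (Fin n) (Fin n) k :=
    Finsupp.linearCombination k fun g => ((ψ g : GL (Fin n) k) : Matrix (Fin n) (Fin n) k)
  have hθ : LinearMap.range θ = ⊤ := by
    rw [Finsupp.range_linearCombination]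
    exact hφ
  have hφmul : ∀ g h : G, ((φ g : GL (Fin n) k) : Matrix (Fin n) (Fin n) k) *
      ((φ h : GL (Fin n) k) : Matrix (Fin n) (Fin n) k) =
        ((φ (g * h) : GL (Fin n) k) : Matrix (Fin n) (Fin n) k) := fun g h => by
    rw [map_mul, Units.val_mul]
  have hψmul : ∀ g h : G, ((ψ g : GL (Fin n) k) : Matrix (Fin n) (Fin n) k) *
      ((ψ h : GL (Fin n) k) : Matrix (Fin n) (Fin n) k) =
        ((ψ (g * h) : GL (Fin n) k) : Matrix (Fin n) (Fin n) k) := fun g h => by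
    rw [map_mul, Units.val_mul]
  -- key step: `ker θ' ≤ ker θ`
  have hker : ∀ c : G →₀ k, θ' c = 0 → θ c = 0 := by
    intro c hc
    -- (i) `tr (θ c * φ h) = 0` for every `h`
    have h1 : ∀ h : G, (θ c * ((φ h : GL (Fin n) k) : Matrix (Fin n) (Fin n) k)).trace = 0 := by
      intro h
      let L : Matrix (Fin n) (Fin n) k →ₗ[k] k :=
        Matrix.traceLinearMap (Fin n) k k ∘ₗ
          LinearMap.mulRight k ((φ h : GL (Fin n) k) : Matrix (Fin n) (Fin n) k)
      let L' : Matrix (Fin n) (Fin n) k →ₗ[k] k :=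
        Matrix.traceLinearMap (Fin n) k k ∘ₗ
          LinearMap.mulRight k ((ψ h : GL (Fin n) k) : Matrix (Fin n) (Fin n) k)
      have hcomp : (L ∘ fun g => ((φ g : GL (Fin n) k) : Matrix (Fin n) (Fin n) k)) =
          (L' ∘ fun g => ((ψ g : GL (Fin n) k) : Matrix (Fin n) (Fin n) k)) := by
        funext g
        simp only [Function.comp_apply, L, L', LinearMap.comp_apply, LinearMap.mulRight_apply,
          Matrix.traceLinearMap_apply, hφmul, hψmul]
        exact htr (g * h)
      have key : L (θ c) = L' (θ' c) := by
        simp only [θ, θ', Finsupp.apply_linearCombination, hcomp]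
      have hL : (θ c * ((φ h : GL (Fin n) k) : Matrix (Fin n) (Fin n) k)).trace = L (θ c) := by
        simp only [L, LinearMap.comp_apply, LinearMap.mulRight_apply, Matrix.traceLinearMap_apply]
      rw [hL, key, hc, map_zero]
    -- (ii) hence `tr (θ c * Y) = 0` for every `Y`, the `φ g` spanning `M_n(k)`
    have h2 : ∀ Y : Matrix (Fin n) (Fin n) k, (θ c * Y).trace = 0 := by
      intro Y
      have hY : Y ∈ Submodule.span k
          (Set.range fun g => ((φ g : GL (Fin n) k) : Matrix (Fin n) (Fin n) k)) := by
        rw [hφ]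
        exact Submodule.mem_top
      induction hY using Submodule.span_induction with
      | mem x hx =>
        obtain ⟨g, rfl⟩ := hx
        exact h1 g
      | zero => rw [mul_zero, Matrix.trace_zero]
      | add x y _ _ hx hy => rw [mul_add, Matrix.trace_add, hx, hy, add_zero]
      | smul a x _ hx => rw [Matrix.mul_smul, Matrix.trace_smul, hx, smul_zero]
    -- (iii) non-degeneracy of the trace form
    exact Matrix.ext_iff_trace_mul_right.2 fun Y => by rw [h2 Y, zero_mul, Matrix.trace_zero]
  -- a linear section `σ` of `θ`; then `θ' ∘ σ` is injective, hence surjective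
  obtain ⟨σ, hσ⟩ := θ.exists_rightInverse_of_surjective hθ
  have hinj : Function.Injective (θ' ∘ₗ σ) := by
    rw [← LinearMap.ker_eq_bot, LinearMap.ker_eq_bot']
    intro Y hY
    have h0 : θ (σ Y) = 0 := hker _ hY
    have hY' : (θ ∘ₗ σ) Y = Y := by
      rw [hσ]
      rfl
    rw [← hY', LinearMap.comp_apply, h0]
  have hsurj : Function.Surjective (θ' ∘ₗ σ) := LinearMap.injective_iff_surjective.1 hinj
  rw [← Finsupp.range_linearCombination]
  refine eq_top_iff.2 fun Y _ => ?_
  obtain ⟨Z, hZ⟩ := hsurj Y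
  exact ⟨σ Z, hZ⟩

/-- **Absolute irreducibility passes from a semisimplification to the representation it
semisimplifies** (`n ≥ 1`): if `τ` is a semisimplification of `τ₀` (`IsSemisimplificationOf`:
`τ` semisimple with the characteristic polynomials of `τ₀`) and `τ` is absolutely irreducible,
then `τ₀` is absolutely irreducible — equal characteristic polynomials give equal traces, Burnside
(`span_eq_top_iff_forall_isIrreducible`) turns absolute irreducibility of `τ` into "the `τ(g)`
span `M_n`", the trace transfer `span_eq_top_of_trace_eq` moves spanning to `τ₀`, and Burnside
converts back.  (So an absolutely irreducible semisimplified reduction IS a reduction, up to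
isomorphism.) [folklore] -/
theorem isAbsIrreducible_of_isSemisimplificationOf (hn : 0 < n) {τ τ₀ : G →* GL (Fin n) k}
    (h : IsSemisimplificationOf τ τ₀) (habs : IsAbsIrreducible τ) : IsAbsIrreducible τ₀ := by
  haveI : Nonempty (Fin n) := ⟨⟨0, hn⟩⟩
  have htr : ∀ g, ((τ g : GL (Fin n) k) : Matrix (Fin n) (Fin n) k).trace =
      ((τ₀ g : GL (Fin n) k) : Matrix (Fin n) (Fin n) k).trace := fun g => by
    rw [Matrix.trace_eq_neg_charpoly_coeff, Matrix.trace_eq_neg_charpoly_coeff, h.2.1 g]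
  have hspan := (span_eq_top_iff_forall_isIrreducible hn τ).2 fun L _ f => habs L f
  intro L _ f
  exact (span_eq_top_iff_forall_isIrreducible hn τ₀).1 (span_eq_top_of_trace_eq τ τ₀ htr hspan) L f

end TraceTransfer

/-! ## The residual bundle of the target forces irreducibility of `r` -/

section Residual

variable {K : Type*} [Field K] {ℓ : ℕ} [Fact ℓ.Prime] {n : ℕ}

/-- **The residual hypotheses of `WeightZeroNonOrdinaryPA` give residual absolute
irreducibility**: if `τ : Γ_K → GL_n(ℤ̄_ℓ/𝔪)` is a residual representation of
`r : Γ_K → GL_n(ℚ̄_ℓ)` (ACC+ sense: a semisimplification of a reduction, `IsResidualRepOf`) and `τ`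
is absolutely irreducible, then `r` is residually absolutely irreducible
(`IsResiduallyAbsIrreducible`: some REDUCTION of `r` is absolutely irreducible) — the reduction
that `τ` semisimplifies is itself absolutely irreducible
(`isAbsIrreducible_of_isSemisimplificationOf`).  `n ≥ 1`. [folklore] -/
theorem isResiduallyAbsIrreducible_of_isResidualRepOf (hn : 0 < n)
    (r : FramedGaloisRep K (PadicAlgCl ℓ) n)
    {τ : Field.absoluteGaloisGroup K →* GL (Fin n) (padicAlgClResidueField ℓ)}
    (hres : r.IsResidualRepOf (RingHom.id _) τ) (habs : IsAbsIrreducible τ) :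
    r.IsResiduallyAbsIrreducible := by
  obtain ⟨τ₀, hred, hss⟩ := hres
  exact ⟨τ₀, hred, isAbsIrreducible_of_isSemisimplificationOf hn hss habs⟩

/-- **… hence `r` is irreducible** (indeed absolutely irreducible: Burnside form of residual
absolute irreducibility, accepted `IsResiduallyAbsIrreducible.isAbsolutelyIrreducible`,
Darmon–Diamond–Taylor 1995 §2.1).  This is the hypothesis `ρ.toGaloisRep.IsIrreducible` of
direction (B) `GaloisToAutomorphic` of the summit, obtained from the target's residual bundle
`r.IsResidualRepOf (RingHom.id _) τ`, `IsAbsIrreducible τ` alone (decomposed genericity,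
enormous image and the scalar element are not needed for it). [folklore] -/
theorem isIrreducible_of_isResidualRepOf (hn : 0 < n) (r : FramedGaloisRep K (PadicAlgCl ℓ) n)
    {τ : Field.absoluteGaloisGroup K →* GL (Fin n) (padicAlgClResidueField ℓ)}
    (hres : r.IsResidualRepOf (RingHom.id _) τ) (habs : IsAbsIrreducible τ) :
    r.toGaloisRep.IsIrreducible :=
  (FramedGaloisRep.IsResiduallyAbsIrreducible.isAbsolutelyIrreducible hn
    (isResiduallyAbsIrreducible_of_isResidualRepOf hn r hres habs)).isIrreducible

end Residual

/-! ## The Galois side of the sector is inside the summit -/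

/-- **`Langlands →` (hypotheses of `WeightZeroNonOrdinaryPA` ⇒ conclusion of the summit's
direction (B) over `K` itself).**  Under the target's binders and hypotheses VERBATIM (CM `K`,
`K^av`, `2 ≤ n`, `ℓ > n²`, `2n < ℓ`, `ℓ` unramified, `ι`, `r`, `τ`, a.e. unramified,
crystalline of labelled weights `{0,…,n-1}` at the PINNED Fontaine datum, the residual bundle),
the summit `_root_.Langlands` yields, for EVERY reciprocity datum `𝓡` and EVERY compactness
witness `hcpt` over `K`, an L-algebraic cuspidal `π` of `GL_n(𝔸_K)` with `Corresponds 𝓡 ι π r`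
(a.e. Satake–Frobenius matching in the summit's normalisation `arithFrobPolyOfSatake ι q_v 1 α`
AND local–global compatibility at every finite place).  Used: irreducibility of `r` from the
residual bundle (`isIrreducible_of_isResidualRepOf`, `0 < n` from `2 ≤ n`); crystalline at the
pinned datum ⇒ de Rham for `𝓡.pst` (`ReciprocityData.pst` IS the pinned datum;
`IsCrystallineFramed.isDeRhamFramed`).  NOT used: CM, `K^av`, the bounds on `ℓ`, unramifiedness
of `ℓ`, the Hodge–Tate weights, decomposed genericity, enormous image, the scalar element.
What this does NOT give is the target's own conclusion — the DRIFT is entirely on the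
automorphic side: `Pi.1.HasWeightZero`, `Pi` unramified above `ℓ`, the HLTT normalisation
`arithFrobPolyOfSatake ι q_v n α`, `∃ hcpt'` (vs `∀ hcpt`) and the extension `K'/K`; so
`Langlands → WeightZeroNonOrdinaryPA` is not available as typed, and a counterexample to the
target either violates THIS statement — then it refutes the summit — or lives in the drift —
then it proves the junction `SectorComplement` ex falso and leaves the summit untouched.
[folklore] -/
theorem galoisSide_of_langlands (hL : _root_.Langlands) :
    ∀ (K : Type) [Field K] [NumberField K], NumberField.IsCMField K →
    ∀ (Kav : Type) [Field Kav] [Algebra K Kav], FiniteDimensional K Kav →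
    ∀ (n : ℕ), 2 ≤ n → ∀ (ℓ : ℕ) [Fact ℓ.Prime], n ^ 2 < ℓ → 2 * n < ℓ →
    Algebra.IsUnramifiedIn (NumberField.RingOfIntegers K) (Ideal.span {(ℓ : ℤ)}) →
    ∀ (ι : PadicAlgCl ℓ ≃+* ℂ) (r : FramedGaloisRep K (PadicAlgCl ℓ) n)
      (τ : Field.absoluteGaloisGroup K →* GL (Fin n) (padicAlgClResidueField ℓ)),
    (∀ᶠ v in Filter.cofinite, r.IsUnramifiedAt v) →
    (∀ (v : IsDedekindDomain.HeightOneSpectrum (NumberField.RingOfIntegers K))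
      (hv : ((ℓ : ℕ) : NumberField.RingOfIntegers K) ∈ v.asIdeal),
      let D := Literature.NumberTheory.PAdicHodge.fontainePstAdicCompletion v ℓ hv
      D.IsCrystallineFramed (r.toLocal v) ∧
      (letI := D.algebra
       ∀ τ' : v.adicCompletion K →ₐ[ℚ_[ℓ]] PadicAlgCl ℓ,
        r.labelledHodgeTateWeightsAt v D.algebra D.𝔅 τ'.toRingHom =
          (Multiset.range n).map fun i : ℕ => (i : ℤ))) →
    r.IsResidualRepOf (RingHom.id _) τ → IsAbsIrreducible τ → IsDecomposedGeneric τ →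
    IsAbsIrreducible (τ.comp (absGaloisGroupAdjoinRootsOfUnity K ℓ).subtype) →
    Subgroup.IsEnormous ((absGaloisGroupAdjoinRootsOfUnity K ℓ).map τ) →
    (∃ σ : Field.absoluteGaloisGroup K, σ ∉ absGaloisGroupAdjoinRootsOfUnity K ℓ ∧
      ∃ c : padicAlgClResidueField ℓ, (τ σ).1 = c • 1) →
    ∀ (𝓡 : Summit.Langlands.ReciprocityData K)
      (hcpt : Literature.NumberTheory.Automorphic.isCompact_glFiniteIntegralLevel n K),
      ∃ π : Literature.NumberTheory.Automorphic.CuspidalAutomorphicRepData n K hcpt,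
        π.1.IsLAlgebraic ∧ Summit.Langlands.Corresponds 𝓡 ι π.1 r := by
  intro K _ _ _hK Kav _ _ _hKav n hn ℓ _ _hn2 _h2n _hunr ι r τ h1 h2 hres habs _hdg _habs' _hen _hσ
    𝓡 hcpt
  obtain ⟨-, h⟩ := hL K
  have hB : Summit.Langlands.GaloisToAutomorphic n 𝓡 hcpt := (h 𝓡 n (by omega) hcpt).2
  have hirr : r.toGaloisRep.IsIrreducible := isIrreducible_of_isResidualRepOf (by omega) r hres habs
  have hgeo : Summit.Langlands.IsGeometricFramed 𝓡 r := ⟨h1, fun v hv => (h2 v hv).1.isDeRhamFramed⟩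
  exact hB ℓ ι r hirr hgeo

end Summit.Langlands.Langlands.Theorems.SectorComplement.Negative

end
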